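import Mathlib
import HarnessLib
import Summits.HubbardSuperconductivity.HubbardSuperconductivity.Theorems.KLProgrammeKLRegimeSymbolIncrementLine
import Summits.HubbardSuperconductivity.HubbardSuperconductivity.Theorems.KLProgrammeKLRegimeSymbolDerivedSampled

/-!
# Route `KLProgramme` — VL child `KLRegimeVolumeLimitV17F2` (stmt-HubbardSuperconductivity-20440), closer MODEL file M2 «MISMATCH-SLICE», bracket (c),
# part 2d: POINTWISE second differences (time, any integer spatial step) of the sampled DIFFERENCE of a multiplier symbol `G(k₀² + e²)·Z` between
# TWO BANDS `e₀, e₁` — every term carries the band increment (`|e₁ − e₀| ≤ P₀`, `‖D(e₁ − e₀)‖ ≤ P₁`, `‖D²(e₁ − e₀)‖ ≤ P₂`)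

Cell `gate-hubbard-kl`, seat hubbard-kl-k3c4-p2 (g11; UV / Matsubara all-U lane), ask «MISMATCH-SLICE» (= M2, bracket (c)) of the VL registrant
k3c4-p1 g11.  Composition of part 2a (`norm_fwdDiff_iter_symbolIncrement_le`: the increment is bounded by the sup over `t ∈ [0,1)` of the second
differences of the DERIVED family at the interpolated band `e_t = e₀ + t(e₁ − e₀)`) with part 2c (`norm_fwdDiff_two_space/time_derivedSymbol_le` at
every `t`, profile `H = G′`).  Generic in: a `C³` profile `G` supported in `[0, Λ²]` with `|G′| ≤ g₁/Λ²`, `|G″| ≤ g₂/Λ⁴`, `|G‴| ≤ g₃/Λ⁶`; two `C²`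
bands with COMMON sup data `|eᵢ| ≤ E₀`, `‖Deᵢ‖ ≤ K₁`, `‖D²eᵢ‖ ≤ K₂` (convex, hence inherited by every `e_t`: `interpBand_data`); the increment
`v = e₁ − e₀` (`P₀, P₁, P₂`); a `C²` factor `Z` (`z₀, z₁, z₂`); the sample `(a₀ + h_f·val q₁, hₓ·q̃₂)`:

* §1 `contDiff_deriv_profile`, `derivProfile_data` (the data of `H = G′`: `h₀ = g₁/Λ²`, `h₁ = g₂/Λ²`, `h₂ = g₃/Λ²`, vanishing above `Λ²`),
  `interpBand_data` (`e_t` is `C²` with the common data for `t ∈ [0,1]`), `interpBand_gt_of_gt` (`Λ < e₀, e₁ ⇒ Λ < e_t`);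
* §2 **`norm_fwdDiff_two_space_symbolDiff_le`** — under the zone condition «near the seam both bands exceed `Λ`»:
  `‖Δ²_{(0,ū)}[G̃₁ − G̃₀](q)‖ ≤ ‖hₓu‖²·Ξ`, `Ξ = ((4h₂+2h₁)K₁²/Λ² + 2h₁K₂/Λ)·ω₀ + 4h₁K₁/Λ·ω₁ + h₀·ω₂` with the `ω`'s of part 2c;
* §3 **`norm_fwdDiff_two_time_symbolDiff_le`** — under the frequency window: `‖Δ²_{(1,0)}[G̃₁ − G̃₀](q)‖ ≤ (4h₂+2h₁)h_f²ω₀/Λ²`.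
* §4 **`norm_fwdDiff_two_space_symbolDiff_le_of_zone`** — §2 with the seam hypothesis in the model's form «both bands exceed `Λ` OR `Z = 0`».

Everything is proved; no definitions, no named facts; nothing about the model is asserted.  The model instance (thin × thin BGM multipliers at the two
top flow frames, p4's `…SymbolFrameInstance`) and the `ℓ¹` character-sum bound via `sum_norm_charSum_le_of_second_differences` follow in part 2e. [folklore]
-/

noncomputable section

namespace Summit.HubbardSuperconductivity.HubbardSuperconductivity.Theorems.TorusFourierL2

set_option linter.dupNamespace false -- summit = problem name (single-conjunct summit), D-0017

open Set Finset Filter Topology Literature.Probability.LatticeModels Literature.Analysis.Calculus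
open scoped Real

/-! ## §1 The derived profile and the interpolated band -/

section Data

/-- `G ∈ C³ ⇒ G′ ∈ C²`. [folklore] -/
theorem contDiff_deriv_profile {G : ℝ → ℝ} (hG : ContDiff ℝ 3 G) : ContDiff ℝ 2 (deriv G) := by
  have h3 : ContDiff ℝ (2 + 1) G := by rw [show ((2 : WithTop ℕ∞) + 1) = 3 by norm_num]; exact hG
  exact (contDiff_succ_iff_deriv.1 h3).2.2

/-- **The data of the derived profile `H = G′`**: `|H| ≤ g₁/Λ²`, `|H′| ≤ (g₂/Λ²)/Λ²`, `|H″| ≤ (g₃/Λ²)/Λ⁴`, and `H = 0` above `Λ²`. [folklore] -/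
theorem derivProfile_data {G : ℝ → ℝ} {Λ g₁ g₂ g₃ : ℝ} (hG1 : ∀ u, |deriv G u| ≤ g₁ / Λ ^ 2)
    (hG2 : ∀ u, |iteratedDeriv 2 G u| ≤ g₂ / Λ ^ 4) (hG3 : ∀ u, |iteratedDeriv 3 G u| ≤ g₃ / Λ ^ 6) (hGv : ∀ u, Λ ^ 2 < u → G u = 0) :
    (∀ u, |deriv G u| ≤ g₁ / Λ ^ 2) ∧ (∀ u, |deriv (deriv G) u| ≤ g₂ / Λ ^ 2 / Λ ^ 2) ∧
      (∀ u, |iteratedDeriv 2 (deriv G) u| ≤ g₃ / Λ ^ 2 / Λ ^ 4) ∧ (∀ u, Λ ^ 2 < u → deriv G u = 0) := by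
  refine ⟨hG1, fun u => ?_, fun u => ?_, fun u hu => (deriv_eq_zero_of_vanish hGv hu).1⟩
  · have h := hG2 u
    rw [iteratedDeriv_succ, iteratedDeriv_one] at h
    rw [div_div, ← pow_add]; exact h
  · have h := hG3 u
    rw [iteratedDeriv_succ'] at h
    rw [div_div, ← pow_add]; exact h

variable {V : Type*} [NormedAddCommGroup V] [NormedSpace ℝ V]

/-- **The interpolated band is convexly admissible**: for `t ∈ [0,1]`, `e_t = e₀ + t(e₁ − e₀)` is `C²` with the common sup data of `e₀, e₁`. [folklore] -/
theorem interpBand_data {e₀ e₁ : V → ℝ} (he₀ : ContDiff ℝ 2 e₀) (he₁ : ContDiff ℝ 2 e₁) {E₀ K₁ K₂ : ℝ}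
    (hE₀ : ∀ p, |e₀ p| ≤ E₀) (hE₁ : ∀ p, |e₁ p| ≤ E₀) (hK₁₀ : ∀ p, ‖fderiv ℝ e₀ p‖ ≤ K₁) (hK₁₁ : ∀ p, ‖fderiv ℝ e₁ p‖ ≤ K₁)
    (hK₂₀ : ∀ p, ‖iteratedFDeriv ℝ 2 e₀ p‖ ≤ K₂) (hK₂₁ : ∀ p, ‖iteratedFDeriv ℝ 2 e₁ p‖ ≤ K₂) {t : ℝ} (ht0 : 0 ≤ t) (ht1 : t ≤ 1) :
    ContDiff ℝ 2 (fun p => e₀ p + t * (e₁ p - e₀ p)) ∧ (∀ p, |e₀ p + t * (e₁ p - e₀ p)| ≤ E₀) ∧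
      (∀ p, ‖fderiv ℝ (fun p => e₀ p + t * (e₁ p - e₀ p)) p‖ ≤ K₁) ∧
      (∀ p, ‖iteratedFDeriv ℝ 2 (fun p => e₀ p + t * (e₁ p - e₀ p)) p‖ ≤ K₂) := by
  have hfun : (fun p => e₀ p + t * (e₁ p - e₀ p)) = fun p => (1 - t) • e₀ p + t • e₁ p := by
    funext p; simp only [smul_eq_mul]; ring
  have hA : ContDiff ℝ 2 (fun p => (1 - t) • e₀ p) := he₀.const_smul (1 - t)
  have hB : ContDiff ℝ 2 (fun p => t • e₁ p) := he₁.const_smul t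
  have hC : ContDiff ℝ 2 (fun p => (1 - t) • e₀ p + t • e₁ p) := hA.add hB
  have h1t : 0 ≤ 1 - t := by linarith
  refine ⟨by rw [hfun]; exact hC, fun p => ?_, fun p => ?_, fun p => ?_⟩
  · calc |e₀ p + t * (e₁ p - e₀ p)| = |(1 - t) * e₀ p + t * e₁ p| := by ring_nf
      _ ≤ |(1 - t) * e₀ p| + |t * e₁ p| := abs_add_le _ _
      _ = (1 - t) * |e₀ p| + t * |e₁ p| := by rw [abs_mul, abs_mul, abs_of_nonneg h1t, abs_of_nonneg ht0]
      _ ≤ (1 - t) * E₀ + t * E₀ := by gcongr <;> first | exact hE₀ p | exact hE₁ p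
      _ = E₀ := by ring
  · rw [hfun]
    have hd₀ : DifferentiableAt ℝ e₀ p := (he₀.differentiable (by norm_num)) p
    have hd₁ : DifferentiableAt ℝ e₁ p := (he₁.differentiable (by norm_num)) p
    have hfd : fderiv ℝ (fun p => (1 - t) • e₀ p + t • e₁ p) p = (1 - t) • fderiv ℝ e₀ p + t • fderiv ℝ e₁ p :=
      ((hd₀.hasFDerivAt.const_smul (1 - t)).add (hd₁.hasFDerivAt.const_smul t)).fderiv
    rw [hfd]
    calc _ ≤ ‖(1 - t) • fderiv ℝ e₀ p‖ + ‖t • fderiv ℝ e₁ p‖ := norm_add_le _ _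
      _ = (1 - t) * ‖fderiv ℝ e₀ p‖ + t * ‖fderiv ℝ e₁ p‖ := by
          rw [norm_smul, norm_smul, Real.norm_of_nonneg h1t, Real.norm_of_nonneg ht0]
      _ ≤ (1 - t) * K₁ + t * K₁ := by gcongr <;> first | exact hK₁₀ p | exact hK₁₁ p
      _ = K₁ := by ring
  · rw [hfun]
    have hfg : (fun p => (1 - t) • e₀ p + t • e₁ p) = (fun p => (1 - t) • e₀ p) + fun p => t • e₁ p := rfl
    rw [hfg, iteratedFDeriv_add_apply hA.contDiffAt hB.contDiffAt, iteratedFDeriv_const_smul_apply' he₀.contDiffAt,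
      iteratedFDeriv_const_smul_apply' he₁.contDiffAt]
    calc _ ≤ ‖(1 - t) • iteratedFDeriv ℝ 2 e₀ p‖ + ‖t • iteratedFDeriv ℝ 2 e₁ p‖ := norm_add_le _ _
      _ = (1 - t) * ‖iteratedFDeriv ℝ 2 e₀ p‖ + t * ‖iteratedFDeriv ℝ 2 e₁ p‖ := by
          rw [norm_smul, norm_smul, Real.norm_of_nonneg h1t, Real.norm_of_nonneg ht0]
      _ ≤ (1 - t) * K₂ + t * K₂ := by gcongr <;> first | exact hK₂₀ p | exact hK₂₁ p
      _ = K₂ := by ring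

omit [NormedAddCommGroup V] [NormedSpace ℝ V] in
/-- If both bands exceed `Λ` at a point then so does every interpolated band (`t ∈ [0,1]`). [folklore] -/
theorem interpBand_gt_of_gt {e₀ e₁ : V → ℝ} {Λ : ℝ} {p : V} (h₀ : Λ < e₀ p) (h₁ : Λ < e₁ p) {t : ℝ} (ht0 : 0 ≤ t) (ht1 : t ≤ 1) :
    Λ < e₀ p + t * (e₁ p - e₀ p) := by
  have : e₀ p + t * (e₁ p - e₀ p) = (1 - t) * e₀ p + t * e₁ p := by ring
  rw [this]
  rcases eq_or_lt_of_le ht0 with rfl | ht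
  · simpa using h₀
  · nlinarith

end Data

/-! ## §2 Space second differences of the sampled symbol difference -/

section Sampled

variable {P L : ℕ} [NeZero P] [NeZero L]

/-- **SPACE SECOND DIFFERENCES OF THE SAMPLED SYMBOL DIFFERENCE BETWEEN TWO BANDS** (see the module docstring; `w = hₓu`):
`‖Δ²_{(0,ū)}[G̃₁ − G̃₀](q)‖ ≤ ‖w‖²·( ((4h₂+2h₁)K₁²/Λ² + 2h₁K₂/Λ)·ω₀ + 4h₁K₁/Λ·ω₁ + h₀·ω₂ )`, `h₀ = g₁/Λ²`, `h₁ = g₂/Λ²`, `h₂ = g₃/Λ²`,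
`ω₀ = 2E₀P₀z₀`, `ω₁ = 2((K₁P₀ + E₀P₁)z₀ + E₀P₀z₁)`, `ω₂ = 2((K₂P₀ + 2K₁P₁ + E₀P₂)z₀ + 2(K₁P₀ + E₀P₁)z₁ + E₀P₀z₂)` — every term carries one of
`P₀, P₁, P₂`. [cite: BenfattoGiulianiMastropietro2006, §2.5 Lemma 2.2 (2.53)–(2.55); §3 (3.3)] -/
theorem norm_fwdDiff_two_space_symbolDiff_le {G : ℝ → ℝ} (hG : ContDiff ℝ 3 G) {Λ g₁ g₂ g₃ : ℝ} (hΛ : 0 < Λ)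
    (hg₂ : 0 ≤ g₂) (hg₃ : 0 ≤ g₃) (hG1 : ∀ u, |deriv G u| ≤ g₁ / Λ ^ 2) (hG2 : ∀ u, |iteratedDeriv 2 G u| ≤ g₂ / Λ ^ 4)
    (hG3 : ∀ u, |iteratedDeriv 3 G u| ≤ g₃ / Λ ^ 6) (hGv : ∀ u, Λ ^ 2 < u → G u = 0)
    {e₀ e₁ Z : (Fin 2 → ℝ) → ℝ} (he₀ : ContDiff ℝ 2 e₀) (he₁ : ContDiff ℝ 2 e₁) (hZ : ContDiff ℝ 2 Z)
    {E₀ K₁ K₂ P₀ P₁ P₂ z₀ z₁ z₂ : ℝ} (hE₀ : ∀ p, |e₀ p| ≤ E₀) (hE₁ : ∀ p, |e₁ p| ≤ E₀)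
    (hK₁₀ : ∀ p, ‖fderiv ℝ e₀ p‖ ≤ K₁) (hK₁₁ : ∀ p, ‖fderiv ℝ e₁ p‖ ≤ K₁)
    (hK₂₀ : ∀ p, ‖iteratedFDeriv ℝ 2 e₀ p‖ ≤ K₂) (hK₂₁ : ∀ p, ‖iteratedFDeriv ℝ 2 e₁ p‖ ≤ K₂)
    (hP₀ : ∀ p, |e₁ p - e₀ p| ≤ P₀) (hP₁ : ∀ p, ‖fderiv ℝ (fun p => e₁ p - e₀ p) p‖ ≤ P₁)
    (hP₂ : ∀ p, ‖iteratedFDeriv ℝ 2 (fun p => e₁ p - e₀ p) p‖ ≤ P₂)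
    (hz₀ : ∀ p, |Z p| ≤ z₀) (hz₁ : ∀ p, ‖fderiv ℝ Z p‖ ≤ z₁) (hz₂ : ∀ p, ‖iteratedFDeriv ℝ 2 Z p‖ ≤ z₂)
    (a₀ hf hx : ℝ) (u : Fin 2 → ℤ)
    (hzone : ∀ m : Fin 2 → ℤ, (∃ j, (L : ℤ) ≤ 2 * |m j| + 2 * (2 : ℕ) * |u j|) →
      Λ < e₀ (fun j => hx * (m j : ℝ)) ∧ Λ < e₁ (fun j => hx * (m j : ℝ)))
    (q : TorusSite 1 P × TorusSite 2 L) :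
    ‖((fwdDiff ((0 : TorusSite 1 P), (fun j => ((u j : ℤ) : ZMod L))))^[2]
        (fun q : TorusSite 1 P × TorusSite 2 L =>
          (((G ((a₀ + hf * (((q.1 0).val : ℕ) : ℝ)) ^ 2 + e₁ (fun j => hx * (((q.2 j).valMinAbs : ℤ) : ℝ)) ^ 2) *
              Z (fun j => hx * (((q.2 j).valMinAbs : ℤ) : ℝ)) : ℝ)) : ℂ) -
          (((G ((a₀ + hf * (((q.1 0).val : ℕ) : ℝ)) ^ 2 + e₀ (fun j => hx * (((q.2 j).valMinAbs : ℤ) : ℝ)) ^ 2) *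
              Z (fun j => hx * (((q.2 j).valMinAbs : ℤ) : ℝ)) : ℝ)) : ℂ))) q‖ ≤
      ‖(fun j => hx * (u j : ℝ))‖ ^ 2 *
        (((4 * (g₃ / Λ ^ 2) + 2 * (g₂ / Λ ^ 2)) * K₁ ^ 2 / Λ ^ 2 + 2 * (g₂ / Λ ^ 2) * K₂ / Λ) * (2 * E₀ * P₀ * z₀) +
          4 * (g₂ / Λ ^ 2) * K₁ / Λ * (2 * ((K₁ * P₀ + E₀ * P₁) * z₀ + E₀ * P₀ * z₁)) +
          g₁ / Λ ^ 2 * (2 * ((K₂ * P₀ + 2 * K₁ * P₁ + E₀ * P₂) * z₀ + 2 * (K₁ * P₀ + E₀ * P₁) * z₁ + E₀ * P₀ * z₂))) := by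
  obtain ⟨hH0, hH1, hH2, hHv⟩ := derivProfile_data hG1 hG2 hG3 hGv
  have hHC : ContDiff ℝ 2 (deriv G) := contDiff_deriv_profile hG
  have hGd : Differentiable ℝ G := hG.differentiable (by norm_num)
  have hv : ContDiff ℝ 2 (fun p => e₁ p - e₀ p) := he₁.sub he₀
  refine norm_fwdDiff_iter_symbolIncrement_le hGd e₀ e₁ Z (fun q : TorusSite 1 P × TorusSite 2 L => a₀ + hf * (((q.1 0).val : ℕ) : ℝ))
    (fun q : TorusSite 1 P × TorusSite 2 L => fun j => hx * (((q.2 j).valMinAbs : ℤ) : ℝ)) _ 2 q fun t ht => ?_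
  obtain ⟨ht0, ht1⟩ := ht
  obtain ⟨hetC, hetE, hetK₁, hetK₂⟩ := interpBand_data he₀ he₁ hE₀ hE₁ hK₁₀ hK₁₁ hK₂₀ hK₂₁ ht0 ht1.le
  -- the derived symbol at parameter `t`
  set Φ : ℝ × (Fin 2 → ℝ) → ℂ := fun kp => (((deriv G (kp.1 ^ 2 + (e₀ kp.2 + t * (e₁ kp.2 - e₀ kp.2)) ^ 2) *
      (2 * (e₀ kp.2 + t * (e₁ kp.2 - e₀ kp.2)) * (e₁ kp.2 - e₀ kp.2)) * Z kp.2 : ℝ)) : ℂ) with hΦdef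
  have hΦ : ∀ k₀ p, Φ (k₀, p) = ((deriv G (k₀ ^ 2 + (fun p => e₀ p + t * (e₁ p - e₀ p)) p ^ 2) *
      (2 * (fun p => e₀ p + t * (e₁ p - e₀ p)) p * (fun p => e₁ p - e₀ p) p) * Z p : ℝ) : ℂ) := fun k₀ p => rfl
  have hzone' : ∀ (k₀ : ℝ) (m : Fin 2 → ℤ), (∃ j, (L : ℤ) ≤ 2 * |m j| + 2 * (2 : ℕ) * |u j|) →
      Φ (k₀, fun j => hx * (m j : ℝ)) = 0 := by
    intro k₀ m hm
    obtain ⟨h0, h1⟩ := hzone m hm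
    have hgt := interpBand_gt_of_gt h0 h1 ht0 ht1.le
    have hu : Λ ^ 2 < k₀ ^ 2 + (e₀ (fun j => hx * (m j : ℝ)) + t * (e₁ (fun j => hx * (m j : ℝ)) - e₀ (fun j => hx * (m j : ℝ)))) ^ 2 := by
      have h1' : Λ ^ 2 < (e₀ (fun j => hx * (m j : ℝ)) + t * (e₁ (fun j => hx * (m j : ℝ)) - e₀ (fun j => hx * (m j : ℝ)))) ^ 2 := by
        have := sq_lt_sq' (by linarith) hgt
        exact this
      nlinarith [sq_nonneg k₀]
    rw [hΦ, hHv _ hu]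
    push_cast
    ring
  exact norm_fwdDiff_two_space_derivedSymbol_le hHC hΛ (by positivity) (by positivity) hH0 hH1 hH2 hHv hetC hv hZ hetE hetK₁ hetK₂
    hP₀ hP₁ hP₂ hz₀ hz₁ hz₂ Φ hΦ a₀ hf hx u hzone' _ (fun q => rfl) q

omit [NeZero L] in
/-- **TIME SECOND DIFFERENCES OF THE SAMPLED SYMBOL DIFFERENCE BETWEEN TWO BANDS**: under the frequency window
(`Λ < |a₀ + h_f m|` for `m < 2` and `m ≥ P − 2`), `‖Δ²_{(1,0)}[G̃₁ − G̃₀](q)‖ ≤ (4h₂+2h₁)·h_f²·(2E₀P₀z₀)/Λ²`.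
[cite: BenfattoGiulianiMastropietro2006, §2.5 Lemma 2.2 (2.52), (2.56); §3 (3.3)] -/
theorem norm_fwdDiff_two_time_symbolDiff_le {G : ℝ → ℝ} (hG : ContDiff ℝ 3 G) {Λ g₁ g₂ g₃ : ℝ} (hΛ : 0 < Λ)
    (hg₂ : 0 ≤ g₂) (hg₃ : 0 ≤ g₃) (hG1 : ∀ u, |deriv G u| ≤ g₁ / Λ ^ 2) (hG2 : ∀ u, |iteratedDeriv 2 G u| ≤ g₂ / Λ ^ 4)
    (hG3 : ∀ u, |iteratedDeriv 3 G u| ≤ g₃ / Λ ^ 6) (hGv : ∀ u, Λ ^ 2 < u → G u = 0)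
    (e₀ e₁ Z : (Fin 2 → ℝ) → ℝ) {E₀ P₀ z₀ : ℝ} (hE₀ : ∀ p, |e₀ p| ≤ E₀) (hE₁ : ∀ p, |e₁ p| ≤ E₀)
    (hP₀ : ∀ p, |e₁ p - e₀ p| ≤ P₀) (hz₀ : ∀ p, |Z p| ≤ z₀) (a₀ hf hx : ℝ)
    (hwin : ∀ m : ℤ, (m < 2 ∨ (P : ℤ) ≤ m + 2) → Λ < |a₀ + hf * (m : ℝ)|)
    (q : TorusSite 1 P × TorusSite 2 L) :
    ‖((fwdDiff ((fun _ : Fin 1 => (1 : ZMod P)), (0 : TorusSite 2 L)))^[2]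
        (fun q : TorusSite 1 P × TorusSite 2 L =>
          (((G ((a₀ + hf * (((q.1 0).val : ℕ) : ℝ)) ^ 2 + e₁ (fun j => hx * (((q.2 j).valMinAbs : ℤ) : ℝ)) ^ 2) *
              Z (fun j => hx * (((q.2 j).valMinAbs : ℤ) : ℝ)) : ℝ)) : ℂ) -
          (((G ((a₀ + hf * (((q.1 0).val : ℕ) : ℝ)) ^ 2 + e₀ (fun j => hx * (((q.2 j).valMinAbs : ℤ) : ℝ)) ^ 2) *
              Z (fun j => hx * (((q.2 j).valMinAbs : ℤ) : ℝ)) : ℝ)) : ℂ))) q‖ ≤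
      (4 * (g₃ / Λ ^ 2) + 2 * (g₂ / Λ ^ 2)) * hf ^ 2 * (2 * E₀ * P₀ * z₀) / Λ ^ 2 := by
  obtain ⟨-, hH1, hH2, hHv⟩ := derivProfile_data hG1 hG2 hG3 hGv
  have hHC : ContDiff ℝ 2 (deriv G) := contDiff_deriv_profile hG
  have hGd : Differentiable ℝ G := hG.differentiable (by norm_num)
  refine norm_fwdDiff_iter_symbolIncrement_le hGd e₀ e₁ Z (fun q : TorusSite 1 P × TorusSite 2 L => a₀ + hf * (((q.1 0).val : ℕ) : ℝ))
    (fun q : TorusSite 1 P × TorusSite 2 L => fun j => hx * (((q.2 j).valMinAbs : ℤ) : ℝ)) _ 2 q fun t ht => ?_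
  obtain ⟨ht0, ht1⟩ := ht
  have hetE : ∀ p, |e₀ p + t * (e₁ p - e₀ p)| ≤ E₀ := by
    intro p
    have h1t : 0 ≤ 1 - t := by linarith [ht1.le]
    calc |e₀ p + t * (e₁ p - e₀ p)| = |(1 - t) * e₀ p + t * e₁ p| := by ring_nf
      _ ≤ |(1 - t) * e₀ p| + |t * e₁ p| := abs_add_le _ _
      _ = (1 - t) * |e₀ p| + t * |e₁ p| := by rw [abs_mul, abs_mul, abs_of_nonneg h1t, abs_of_nonneg ht0]
      _ ≤ (1 - t) * E₀ + t * E₀ := by gcongr <;> first | exact hE₀ p | exact hE₁ p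
      _ = E₀ := by ring
  set Φ : ℝ × (Fin 2 → ℝ) → ℂ := fun kp => (((deriv G (kp.1 ^ 2 + (e₀ kp.2 + t * (e₁ kp.2 - e₀ kp.2)) ^ 2) *
      (2 * (e₀ kp.2 + t * (e₁ kp.2 - e₀ kp.2)) * (e₁ kp.2 - e₀ kp.2)) * Z kp.2 : ℝ)) : ℂ) with hΦdef
  have hΦ : ∀ k₀ p, Φ (k₀, p) = ((deriv G (k₀ ^ 2 + (fun p => e₀ p + t * (e₁ p - e₀ p)) p ^ 2) *
      (2 * (fun p => e₀ p + t * (e₁ p - e₀ p)) p * (fun p => e₁ p - e₀ p) p) * Z p : ℝ) : ℂ) := fun k₀ p => rfl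
  exact norm_fwdDiff_two_time_derivedSymbol_le hHC hΛ (by positivity) (by positivity) hH1 hH2 hHv
    (fun p => e₀ p + t * (e₁ p - e₀ p)) (fun p => e₁ p - e₀ p) Z hetE hP₀ hz₀ Φ hΦ a₀ hf hx hwin _ (fun q => rfl) q

/-- **SPACE SECOND DIFFERENCES OF THE SAMPLED SYMBOL DIFFERENCE — ZONE HYPOTHESIS IN THE MODEL'S FORM**: the same bound as
`norm_fwdDiff_two_space_symbolDiff_le`, with the seam hypothesis weakened to «both bands exceed `Λ` OR the angular factor vanishes» at the
seam momenta (in the model the band inequality holds on the strip `π − z ≤ |p_j| ≤ π + z` and the angular factor kills `|p_j| ≥ π + z`;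
either way the derived symbol `G′(k₀² + e_t²)·(2e_t v)·Z` vanishes there). [cite: BenfattoGiulianiMastropietro2006, §2.5 Lemma 2.2 (2.53)–(2.55); §3 (3.3)] -/
theorem norm_fwdDiff_two_space_symbolDiff_le_of_zone {G : ℝ → ℝ} (hG : ContDiff ℝ 3 G) {Λ g₁ g₂ g₃ : ℝ} (hΛ : 0 < Λ)
    (hg₂ : 0 ≤ g₂) (hg₃ : 0 ≤ g₃) (hG1 : ∀ u, |deriv G u| ≤ g₁ / Λ ^ 2) (hG2 : ∀ u, |iteratedDeriv 2 G u| ≤ g₂ / Λ ^ 4)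
    (hG3 : ∀ u, |iteratedDeriv 3 G u| ≤ g₃ / Λ ^ 6) (hGv : ∀ u, Λ ^ 2 < u → G u = 0)
    {e₀ e₁ Z : (Fin 2 → ℝ) → ℝ} (he₀ : ContDiff ℝ 2 e₀) (he₁ : ContDiff ℝ 2 e₁) (hZ : ContDiff ℝ 2 Z)
    {E₀ K₁ K₂ P₀ P₁ P₂ z₀ z₁ z₂ : ℝ} (hE₀ : ∀ p, |e₀ p| ≤ E₀) (hE₁ : ∀ p, |e₁ p| ≤ E₀)
    (hK₁₀ : ∀ p, ‖fderiv ℝ e₀ p‖ ≤ K₁) (hK₁₁ : ∀ p, ‖fderiv ℝ e₁ p‖ ≤ K₁)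
    (hK₂₀ : ∀ p, ‖iteratedFDeriv ℝ 2 e₀ p‖ ≤ K₂) (hK₂₁ : ∀ p, ‖iteratedFDeriv ℝ 2 e₁ p‖ ≤ K₂)
    (hP₀ : ∀ p, |e₁ p - e₀ p| ≤ P₀) (hP₁ : ∀ p, ‖fderiv ℝ (fun p => e₁ p - e₀ p) p‖ ≤ P₁)
    (hP₂ : ∀ p, ‖iteratedFDeriv ℝ 2 (fun p => e₁ p - e₀ p) p‖ ≤ P₂)
    (hz₀ : ∀ p, |Z p| ≤ z₀) (hz₁ : ∀ p, ‖fderiv ℝ Z p‖ ≤ z₁) (hz₂ : ∀ p, ‖iteratedFDeriv ℝ 2 Z p‖ ≤ z₂)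
    (a₀ hf hx : ℝ) (u : Fin 2 → ℤ)
    (hzone : ∀ m : Fin 2 → ℤ, (∃ j, (L : ℤ) ≤ 2 * |m j| + 2 * (2 : ℕ) * |u j|) →
      (Λ < e₀ (fun j => hx * (m j : ℝ)) ∧ Λ < e₁ (fun j => hx * (m j : ℝ))) ∨ Z (fun j => hx * (m j : ℝ)) = 0)
    (q : TorusSite 1 P × TorusSite 2 L) :
    ‖((fwdDiff ((0 : TorusSite 1 P), (fun j => ((u j : ℤ) : ZMod L))))^[2]
        (fun q : TorusSite 1 P × TorusSite 2 L =>
          (((G ((a₀ + hf * (((q.1 0).val : ℕ) : ℝ)) ^ 2 + e₁ (fun j => hx * (((q.2 j).valMinAbs : ℤ) : ℝ)) ^ 2) *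
              Z (fun j => hx * (((q.2 j).valMinAbs : ℤ) : ℝ)) : ℝ)) : ℂ) -
          (((G ((a₀ + hf * (((q.1 0).val : ℕ) : ℝ)) ^ 2 + e₀ (fun j => hx * (((q.2 j).valMinAbs : ℤ) : ℝ)) ^ 2) *
              Z (fun j => hx * (((q.2 j).valMinAbs : ℤ) : ℝ)) : ℝ)) : ℂ))) q‖ ≤
      ‖(fun j => hx * (u j : ℝ))‖ ^ 2 *
        (((4 * (g₃ / Λ ^ 2) + 2 * (g₂ / Λ ^ 2)) * K₁ ^ 2 / Λ ^ 2 + 2 * (g₂ / Λ ^ 2) * K₂ / Λ) * (2 * E₀ * P₀ * z₀) +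
          4 * (g₂ / Λ ^ 2) * K₁ / Λ * (2 * ((K₁ * P₀ + E₀ * P₁) * z₀ + E₀ * P₀ * z₁)) +
          g₁ / Λ ^ 2 * (2 * ((K₂ * P₀ + 2 * K₁ * P₁ + E₀ * P₂) * z₀ + 2 * (K₁ * P₀ + E₀ * P₁) * z₁ + E₀ * P₀ * z₂))) := by
  obtain ⟨hH0, hH1, hH2, hHv⟩ := derivProfile_data hG1 hG2 hG3 hGv
  have hHC : ContDiff ℝ 2 (deriv G) := contDiff_deriv_profile hG
  have hGd : Differentiable ℝ G := hG.differentiable (by norm_num)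
  have hv : ContDiff ℝ 2 (fun p => e₁ p - e₀ p) := he₁.sub he₀
  refine norm_fwdDiff_iter_symbolIncrement_le hGd e₀ e₁ Z (fun q : TorusSite 1 P × TorusSite 2 L => a₀ + hf * (((q.1 0).val : ℕ) : ℝ))
    (fun q : TorusSite 1 P × TorusSite 2 L => fun j => hx * (((q.2 j).valMinAbs : ℤ) : ℝ)) _ 2 q fun t ht => ?_
  obtain ⟨ht0, ht1⟩ := ht
  obtain ⟨hetC, hetE, hetK₁, hetK₂⟩ := interpBand_data he₀ he₁ hE₀ hE₁ hK₁₀ hK₁₁ hK₂₀ hK₂₁ ht0 ht1.le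
  set Φ : ℝ × (Fin 2 → ℝ) → ℂ := fun kp => (((deriv G (kp.1 ^ 2 + (e₀ kp.2 + t * (e₁ kp.2 - e₀ kp.2)) ^ 2) *
      (2 * (e₀ kp.2 + t * (e₁ kp.2 - e₀ kp.2)) * (e₁ kp.2 - e₀ kp.2)) * Z kp.2 : ℝ)) : ℂ) with hΦdef
  have hΦ : ∀ k₀ p, Φ (k₀, p) = ((deriv G (k₀ ^ 2 + (fun p => e₀ p + t * (e₁ p - e₀ p)) p ^ 2) *
      (2 * (fun p => e₀ p + t * (e₁ p - e₀ p)) p * (fun p => e₁ p - e₀ p) p) * Z p : ℝ) : ℂ) := fun k₀ p => rfl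
  have hzone' : ∀ (k₀ : ℝ) (m : Fin 2 → ℤ), (∃ j, (L : ℤ) ≤ 2 * |m j| + 2 * (2 : ℕ) * |u j|) →
      Φ (k₀, fun j => hx * (m j : ℝ)) = 0 := by
    intro k₀ m hm
    rcases hzone m hm with ⟨h0, h1⟩ | hZ0
    · have hgt := interpBand_gt_of_gt h0 h1 ht0 ht1.le
      have hu : Λ ^ 2 < k₀ ^ 2 + (e₀ (fun j => hx * (m j : ℝ)) + t * (e₁ (fun j => hx * (m j : ℝ)) - e₀ (fun j => hx * (m j : ℝ)))) ^ 2 := by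
        have h1' : Λ ^ 2 < (e₀ (fun j => hx * (m j : ℝ)) + t * (e₁ (fun j => hx * (m j : ℝ)) - e₀ (fun j => hx * (m j : ℝ)))) ^ 2 :=
          sq_lt_sq' (by linarith) hgt
        nlinarith [sq_nonneg k₀]
      rw [hΦ, hHv _ hu]
      push_cast
      ring
    · rw [hΦ, hZ0, mul_zero, Complex.ofReal_zero]
  exact norm_fwdDiff_two_space_derivedSymbol_le hHC hΛ (by positivity) (by positivity) hH0 hH1 hH2 hHv hetC hv hZ hetE hetK₁ hetK₂
    hP₀ hP₁ hP₂ hz₀ hz₁ hz₂ Φ hΦ a₀ hf hx u hzone' _ (fun q => rfl) q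

end Sampled

end Summit.HubbardSuperconductivity.HubbardSuperconductivity.Theorems.TorusFourierL2

end
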